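import Summits.Ventures.YMGap.Thresholds.OneLinkLawBiInvariance
import Summits.Ventures.YMGap.Thresholds.OneLinkHolleyStroock
import HarnessLib

/-!
# Torus-block structure of the one-link covariance at a diagonal tilt ((L4) of the `SU(3)` variance certificate)

HONEST FRAMING.  Exact identities for ONE tilted Haar law on `SU(N)` (explicit strong-coupling bookkeeping for lattice `SU(N)` Yang–Mills, small `β`);
certifies nothing; NOT weak coupling, NOT a continuum statement, NOT a Yang–Mills mass-gap claim.  Cell `pub-ymgap` (venture `YMGap`), seat engine-2 (g13).
This is the written [analysis] lemma (L4) «TORUS BLOCK STRUCTURE» of the cell `pub-balaban`'s C-iv certificate spec for H2 = `OneLinkVarianceBound 3 (11/30) (49/20)`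
(`CERT-SPEC-sigma1-v2.md`), made a kernel theorem: the certificate's engines bound the variance form of `ν_B`, `B = e^{iφ}diag(s)`, BLOCK BY BLOCK
(`D` = diagonal directions, `O_{ab}` = the entry pair `(a,b),(b,a)`); this file proves that block bounds imply the bound for every direction `Δ`.

THE ARGUMENT (folklore; Schur's lemma for the diagonal torus, here with SIGN matrices only).  If `t ∈ SU(N)` commutes with `B` then `ν_B` is invariant under
`g ↦ t⁻¹ g t` (bi-invariance, `OneLinkLawBiInvariance`), so `Var_{ν_B}(N Re tr(gΔ)) = Var_{ν_B}(N Re tr(g·t⁻¹Δt))` (`variance_linear_torus`).  If `t⁻¹Δ₁t = Δ₁` and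
`t⁻¹Δ₂t = −Δ₂` then `Var(lin(Δ₁+Δ₂)) = Var(lin(Δ₁−Δ₂))`, hence by the parallelogram law `Cov(lin Δ₁, lin Δ₂) = 0` and
`Var(lin(Δ₁+Δ₂)) = Var(lin Δ₁) + Var(lin Δ₂)` (`variance_linear_add_of_sign_symmetry`); with disjoint supports `‖Δ₁+Δ₂‖_F² = ‖Δ₁‖_F² + ‖Δ₂‖_F²`, so variance BOUNDS
add (`varianceLinBound_add_of_sign_symmetry`).  For `N = 3` the two sign matrices `diag(1,−1,−1)`, `diag(−1,1,−1) ∈ SU(3)` separate the four blocks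
`D ⊕ O₁₂ ⊕ O₀₁ ⊕ O₀₂` (indices in `Fin 3`), whence ★ `su3_varianceBoundAt_diagonal_of_blocks`: at a DIAGONAL tilt `B = diagonal d` of `SU(3)`, if
`Var_{ν_B}(3 Re tr(gΔ)) ≤ v‖Δ‖_F²` for every `Δ` supported in ONE block, then it holds for every `Δ`.

References: standard (Schur orthogonality for a torus action); the cell's CERT-SPEC (L4).
-/

noncomputable section

open scoped Matrix ComplexConjugate BigOperators
open Matrix Complex MeasureTheory ProbabilityTheory
open Literature.MathematicalPhysics.QuantumFieldTheory
open Literature.MathematicalPhysics.QuantumFieldTheory.SUNBakryEmery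
open Summit.Ventures.YMGap.OneLinkBiInvariance
open Summit.Ventures.YMGap.OneLinkHolleyStroock (measurable_tilt abs_tilt_le isProbabilityMeasure_wilson)

namespace Summit.Ventures.YMGap.OneLinkTorusBlocks

variable {N : ℕ}

/-! ## 1. Invariance of the linear-observable variance under a group element commuting with the tilt -/

/-- **Torus invariance**: if `t ∈ SU(N)` satisfies `t B t⁻¹ = B` then `Var_{ν_B}(N Re tr(gΔ)) = Var_{ν_B}(N Re tr(g · t⁻¹Δt))`. [folklore] -/
theorem variance_linear_torus (t : SUN N) {B : Matrix (Fin N) (Fin N) ℂ}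
    (htB : (t : Matrix (Fin N) (Fin N) ℂ) * B * ((t⁻¹ : SUN N) : Matrix (Fin N) (Fin N) ℂ) = B) (Δ : Matrix (Fin N) (Fin N) ℂ) :
    Var[fun g : SUN N => (N : ℝ) * ((g : Matrix (Fin N) (Fin N) ℂ) * Δ).trace.re ;
        (haarSU N).tilted fun g => (N : ℝ) * ((g : Matrix (Fin N) (Fin N) ℂ) * B).trace.re] =
      Var[fun g : SUN N => (N : ℝ) * ((g : Matrix (Fin N) (Fin N) ℂ) *
          (((t⁻¹ : SUN N) : Matrix (Fin N) (Fin N) ℂ) * Δ * (t : Matrix (Fin N) (Fin N) ℂ))).trace.re ;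
        (haarSU N).tilted fun g => (N : ℝ) * ((g : Matrix (Fin N) (Fin N) ℂ) * B).trace.re] := by
  have key := variance_linear_conj t t⁻¹ B Δ
  rw [htB, inv_inv] at key
  exact key

/-! ## 2. Sign symmetry ⇒ orthogonality ⇒ variances (and variance bounds) add -/

/-- The linear observable is additive in the direction: `N Re tr(g(Δ₁+Δ₂)) = N Re tr(gΔ₁) + N Re tr(gΔ₂)`. [folklore] -/
theorem linear_add (Δ₁ Δ₂ : Matrix (Fin N) (Fin N) ℂ) :
    (fun g : SUN N => (N : ℝ) * ((g : Matrix (Fin N) (Fin N) ℂ) * (Δ₁ + Δ₂)).trace.re) =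
      (fun g : SUN N => (N : ℝ) * ((g : Matrix (Fin N) (Fin N) ℂ) * Δ₁).trace.re) +
        fun g : SUN N => (N : ℝ) * ((g : Matrix (Fin N) (Fin N) ℂ) * Δ₂).trace.re := by
  funext g
  rw [Pi.add_apply, Matrix.mul_add, Matrix.trace_add, Complex.add_re, mul_add]

/-- … and `N Re tr(g(Δ₁−Δ₂)) = N Re tr(gΔ₁) − N Re tr(gΔ₂)`. [folklore] -/
theorem linear_sub (Δ₁ Δ₂ : Matrix (Fin N) (Fin N) ℂ) :
    (fun g : SUN N => (N : ℝ) * ((g : Matrix (Fin N) (Fin N) ℂ) * (Δ₁ - Δ₂)).trace.re) =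
      (fun g : SUN N => (N : ℝ) * ((g : Matrix (Fin N) (Fin N) ℂ) * Δ₁).trace.re) -
        fun g : SUN N => (N : ℝ) * ((g : Matrix (Fin N) (Fin N) ℂ) * Δ₂).trace.re := by
  funext g
  rw [Pi.sub_apply, Matrix.mul_sub, Matrix.trace_sub, Complex.sub_re, mul_sub]

/-- The linear observable is square integrable under `ν_B` (bounded continuous on a probability space). [folklore] -/
theorem memLp_two_linear (B Δ : Matrix (Fin N) (Fin N) ℂ) :
    MemLp (fun g : SUN N => (N : ℝ) * ((g : Matrix (Fin N) (Fin N) ℂ) * Δ).trace.re) 2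
      ((haarSU N).tilted fun g => (N : ℝ) * ((g : Matrix (Fin N) (Fin N) ℂ) * B).trace.re) := by
  haveI := isProbabilityMeasure_wilson (N := N) B
  exact MemLp.of_bound (measurable_tilt Δ).aestronglyMeasurable ((N : ℝ) * (Real.sqrt N * frobNorm Δ))
    (ae_of_all _ fun g => by rw [Real.norm_eq_abs]; exact abs_tilt_le Δ g)

/-- **Sign symmetry ⇒ variances add.**  If `t ∈ SU(N)` commutes with `B`, fixes `Δ₁` and negates `Δ₂` under `Δ ↦ t⁻¹Δt`, then
`Var_{ν_B}(lin(Δ₁+Δ₂)) = Var_{ν_B}(lin Δ₁) + Var_{ν_B}(lin Δ₂)` (the covariance vanishes by the parallelogram law). [folklore] -/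
theorem variance_linear_add_of_sign_symmetry (t : SUN N) {B Δ₁ Δ₂ : Matrix (Fin N) (Fin N) ℂ}
    (htB : (t : Matrix (Fin N) (Fin N) ℂ) * B * ((t⁻¹ : SUN N) : Matrix (Fin N) (Fin N) ℂ) = B)
    (h₁ : ((t⁻¹ : SUN N) : Matrix (Fin N) (Fin N) ℂ) * Δ₁ * (t : Matrix (Fin N) (Fin N) ℂ) = Δ₁)
    (h₂ : ((t⁻¹ : SUN N) : Matrix (Fin N) (Fin N) ℂ) * Δ₂ * (t : Matrix (Fin N) (Fin N) ℂ) = -Δ₂) :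
    Var[fun g : SUN N => (N : ℝ) * ((g : Matrix (Fin N) (Fin N) ℂ) * (Δ₁ + Δ₂)).trace.re ;
        (haarSU N).tilted fun g => (N : ℝ) * ((g : Matrix (Fin N) (Fin N) ℂ) * B).trace.re] =
      Var[fun g : SUN N => (N : ℝ) * ((g : Matrix (Fin N) (Fin N) ℂ) * Δ₁).trace.re ;
          (haarSU N).tilted fun g => (N : ℝ) * ((g : Matrix (Fin N) (Fin N) ℂ) * B).trace.re] +
        Var[fun g : SUN N => (N : ℝ) * ((g : Matrix (Fin N) (Fin N) ℂ) * Δ₂).trace.re ;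
          (haarSU N).tilted fun g => (N : ℝ) * ((g : Matrix (Fin N) (Fin N) ℂ) * B).trace.re] := by
  haveI := isProbabilityMeasure_wilson (N := N) B
  have hX := memLp_two_linear (N := N) B Δ₁
  have hY := memLp_two_linear (N := N) B Δ₂
  -- `t⁻¹ (Δ₁ + Δ₂) t = Δ₁ − Δ₂`
  have hconj : ((t⁻¹ : SUN N) : Matrix (Fin N) (Fin N) ℂ) * (Δ₁ + Δ₂) * (t : Matrix (Fin N) (Fin N) ℂ) = Δ₁ - Δ₂ := by
    rw [Matrix.mul_add, Matrix.add_mul, h₁, h₂, sub_eq_add_neg]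
  -- `Var(lin(Δ₁+Δ₂)) = Var(lin(Δ₁−Δ₂))`
  have hinv := variance_linear_torus t htB (Δ₁ + Δ₂)
  rw [hconj] at hinv
  rw [linear_add, linear_sub, variance_add hX hY, variance_sub hX hY] at hinv
  rw [linear_add, variance_add hX hY]
  linarith

/-- Frobenius norms of matrices with disjoint supports add in square. [folklore] -/
theorem frobNorm_sq_add_of_disjoint {Δ₁ Δ₂ : Matrix (Fin N) (Fin N) ℂ} (h : ∀ i j, Δ₁ i j = 0 ∨ Δ₂ i j = 0) :
    frobNorm (Δ₁ + Δ₂) ^ 2 = frobNorm Δ₁ ^ 2 + frobNorm Δ₂ ^ 2 := by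
  rw [frobNorm_sq, frobNorm_sq, frobNorm_sq, ← Finset.sum_add_distrib]
  refine Finset.sum_congr rfl fun i _ => ?_
  rw [← Finset.sum_add_distrib]
  refine Finset.sum_congr rfl fun j _ => ?_
  rw [Matrix.add_apply]
  rcases h i j with h0 | h0 <;> rw [h0] <;> simp

/-- **Variance bounds add across a sign symmetry**: with `t`, `Δ₁`, `Δ₂` as in `variance_linear_add_of_sign_symmetry` and disjoint supports, bounds
`v‖Δ₁‖_F²`, `v‖Δ₂‖_F²` give `v‖Δ₁+Δ₂‖_F²`. [folklore] -/
theorem varianceLinBound_add_of_sign_symmetry (t : SUN N) {B Δ₁ Δ₂ : Matrix (Fin N) (Fin N) ℂ} {v : ℝ}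
    (htB : (t : Matrix (Fin N) (Fin N) ℂ) * B * ((t⁻¹ : SUN N) : Matrix (Fin N) (Fin N) ℂ) = B)
    (h₁ : ((t⁻¹ : SUN N) : Matrix (Fin N) (Fin N) ℂ) * Δ₁ * (t : Matrix (Fin N) (Fin N) ℂ) = Δ₁)
    (h₂ : ((t⁻¹ : SUN N) : Matrix (Fin N) (Fin N) ℂ) * Δ₂ * (t : Matrix (Fin N) (Fin N) ℂ) = -Δ₂)
    (hdisj : ∀ i j, Δ₁ i j = 0 ∨ Δ₂ i j = 0)
    (hb₁ : Var[fun g : SUN N => (N : ℝ) * ((g : Matrix (Fin N) (Fin N) ℂ) * Δ₁).trace.re ;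
        (haarSU N).tilted fun g => (N : ℝ) * ((g : Matrix (Fin N) (Fin N) ℂ) * B).trace.re] ≤ v * frobNorm Δ₁ ^ 2)
    (hb₂ : Var[fun g : SUN N => (N : ℝ) * ((g : Matrix (Fin N) (Fin N) ℂ) * Δ₂).trace.re ;
        (haarSU N).tilted fun g => (N : ℝ) * ((g : Matrix (Fin N) (Fin N) ℂ) * B).trace.re] ≤ v * frobNorm Δ₂ ^ 2) :
    Var[fun g : SUN N => (N : ℝ) * ((g : Matrix (Fin N) (Fin N) ℂ) * (Δ₁ + Δ₂)).trace.re ;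
        (haarSU N).tilted fun g => (N : ℝ) * ((g : Matrix (Fin N) (Fin N) ℂ) * B).trace.re] ≤ v * frobNorm (Δ₁ + Δ₂) ^ 2 := by
  rw [variance_linear_add_of_sign_symmetry t htB h₁ h₂, frobNorm_sq_add_of_disjoint hdisj, mul_add]
  exact add_le_add hb₁ hb₂

/-! ## 3. `SU(3)`: the two sign matrices and the four blocks -/

section SU3

/-- The sign matrix `diag(ε)` (`ε = ±1`, product `1`) as an element of `SU(3)`: `diag(1,−1,−1)`. [folklore] -/
theorem signA_mem : (diagonal ![(1 : ℂ), -1, -1] : Matrix (Fin 3) (Fin 3) ℂ) ∈ Matrix.specialUnitaryGroup (Fin 3) ℂ := by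
  refine Matrix.mem_specialUnitaryGroup_iff.2 ⟨Matrix.mem_unitaryGroup_iff.2 ?_, ?_⟩
  · rw [Matrix.star_eq_conjTranspose, Matrix.diagonal_conjTranspose, Matrix.diagonal_mul_diagonal, ← Matrix.diagonal_one]
    congr 1
    funext i
    fin_cases i <;> simp
  · rw [Matrix.det_diagonal, Fin.prod_univ_three]
    simp

/-- The sign matrix `diag(−1,1,−1) ∈ SU(3)`. [folklore] -/
theorem signB_mem : (diagonal ![(-1 : ℂ), 1, -1] : Matrix (Fin 3) (Fin 3) ℂ) ∈ Matrix.specialUnitaryGroup (Fin 3) ℂ := by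
  refine Matrix.mem_specialUnitaryGroup_iff.2 ⟨Matrix.mem_unitaryGroup_iff.2 ?_, ?_⟩
  · rw [Matrix.star_eq_conjTranspose, Matrix.diagonal_conjTranspose, Matrix.diagonal_mul_diagonal, ← Matrix.diagonal_one]
    congr 1
    funext i
    fin_cases i <;> simp
  · rw [Matrix.det_diagonal, Fin.prod_univ_three]
    simp

/-- A sign matrix is its own inverse in `SU(3)` (as a matrix statement about the group inverse). [folklore] -/
theorem coe_inv_of_mul_self {t : SUN 3} (h : t * t = 1) : ((t⁻¹ : SUN 3) : Matrix (Fin 3) (Fin 3) ℂ) = (t : Matrix (Fin 3) (Fin 3) ℂ) := by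
  rw [inv_eq_of_mul_eq_one_right h]

/-- `diag(ε)² = 1` in `SU(3)` for `ε = (1,−1,−1)`. [folklore] -/
theorem signA_mul_self : (⟨_, signA_mem⟩ : SUN 3) * ⟨_, signA_mem⟩ = 1 := by
  apply Subtype.ext
  show diagonal ![(1 : ℂ), -1, -1] * diagonal ![(1 : ℂ), -1, -1] = 1
  rw [Matrix.diagonal_mul_diagonal, ← Matrix.diagonal_one]
  congr 1
  funext i
  fin_cases i <;> simp

/-- `diag(ε)² = 1` in `SU(3)` for `ε = (−1,1,−1)`. [folklore] -/
theorem signB_mul_self : (⟨_, signB_mem⟩ : SUN 3) * ⟨_, signB_mem⟩ = 1 := by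
  apply Subtype.ext
  show diagonal ![(-1 : ℂ), 1, -1] * diagonal ![(-1 : ℂ), 1, -1] = 1
  rw [Matrix.diagonal_mul_diagonal, ← Matrix.diagonal_one]
  congr 1
  funext i
  fin_cases i <;> simp

/-- A diagonal sign matrix commutes with a diagonal tilt: `t · diagonal d · t⁻¹ = diagonal d`. [folklore] -/
theorem sign_conj_diagonal {t : SUN 3} {ε : Fin 3 → ℂ} (ht : (t : Matrix (Fin 3) (Fin 3) ℂ) = diagonal ε) (htt : t * t = 1)
    (hε : ∀ i, ε i * ε i = 1) (d : Fin 3 → ℂ) :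
    (t : Matrix (Fin 3) (Fin 3) ℂ) * diagonal d * ((t⁻¹ : SUN 3) : Matrix (Fin 3) (Fin 3) ℂ) = diagonal d := by
  rw [coe_inv_of_mul_self htt, ht, Matrix.diagonal_mul_diagonal, Matrix.diagonal_mul_diagonal]
  congr 1
  funext i
  rw [mul_comm (ε i) (d i), mul_assoc, hε, mul_one]

/-- Conjugating a direction by a diagonal sign matrix multiplies entry `(i,j)` by `εᵢεⱼ`. [folklore] -/
theorem sign_conj_apply {t : SUN 3} {ε : Fin 3 → ℂ} (ht : (t : Matrix (Fin 3) (Fin 3) ℂ) = diagonal ε) (htt : t * t = 1)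
    (Δ : Matrix (Fin 3) (Fin 3) ℂ) (i j : Fin 3) :
    (((t⁻¹ : SUN 3) : Matrix (Fin 3) (Fin 3) ℂ) * Δ * (t : Matrix (Fin 3) (Fin 3) ℂ)) i j = ε i * ε j * Δ i j := by
  rw [coe_inv_of_mul_self htt, ht, Matrix.mul_diagonal, Matrix.diagonal_mul]
  ring

/-- Even part under `εᵢεⱼ`: if `Δ` is supported where `εᵢεⱼ = 1` then `t⁻¹Δt = Δ`. [folklore] -/
theorem sign_conj_eq_self_of_support {t : SUN 3} {ε : Fin 3 → ℂ} (ht : (t : Matrix (Fin 3) (Fin 3) ℂ) = diagonal ε) (htt : t * t = 1)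
    {Δ : Matrix (Fin 3) (Fin 3) ℂ} (hΔ : ∀ i j, Δ i j ≠ 0 → ε i * ε j = 1) :
    ((t⁻¹ : SUN 3) : Matrix (Fin 3) (Fin 3) ℂ) * Δ * (t : Matrix (Fin 3) (Fin 3) ℂ) = Δ := by
  ext i j
  rw [sign_conj_apply ht htt]
  by_cases h : Δ i j = 0
  · rw [h, mul_zero]
  · rw [hΔ i j h, one_mul]

/-- Odd part: if `Δ` is supported where `εᵢεⱼ = −1` then `t⁻¹Δt = −Δ`. [folklore] -/
theorem sign_conj_eq_neg_of_support {t : SUN 3} {ε : Fin 3 → ℂ} (ht : (t : Matrix (Fin 3) (Fin 3) ℂ) = diagonal ε) (htt : t * t = 1)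
    {Δ : Matrix (Fin 3) (Fin 3) ℂ} (hΔ : ∀ i j, Δ i j ≠ 0 → ε i * ε j = -1) :
    ((t⁻¹ : SUN 3) : Matrix (Fin 3) (Fin 3) ℂ) * Δ * (t : Matrix (Fin 3) (Fin 3) ℂ) = -Δ := by
  ext i j
  rw [sign_conj_apply ht htt, Matrix.neg_apply]
  by_cases h : Δ i j = 0
  · rw [h, mul_zero, neg_zero]
  · rw [hΔ i j h, neg_one_mul]

/-- Entries of a conjugated PIECE: the piece of `Δ` on a Boolean index predicate `P` (other entries zeroed; written with `Matrix.of`, no definition)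
has support inside `P`. [folklore] -/
theorem piece_ne_zero (P : Fin 3 → Fin 3 → Bool) (Δ : Matrix (Fin 3) (Fin 3) ℂ) (i j : Fin 3)
    (h : (Matrix.of fun i j => if P i j then Δ i j else 0) i j ≠ 0) : P i j = true := by
  by_contra hc
  apply h
  simp only [Matrix.of_apply]
  rw [if_neg hc]

/-- A piece whose index predicate has constant sign `εᵢεⱼ = 1` is FIXED by the sign conjugation. [folklore] -/
theorem piece_even {t : SUN 3} {ε : Fin 3 → ℂ} (ht : (t : Matrix (Fin 3) (Fin 3) ℂ) = diagonal ε) (htt : t * t = 1)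
    (P : Fin 3 → Fin 3 → Bool) (hP : ∀ i j, P i j = true → ε i * ε j = 1) (Δ : Matrix (Fin 3) (Fin 3) ℂ) :
    ((t⁻¹ : SUN 3) : Matrix (Fin 3) (Fin 3) ℂ) * (Matrix.of fun i j => if P i j then Δ i j else 0) * (t : Matrix (Fin 3) (Fin 3) ℂ) = (Matrix.of fun i j => if P i j then Δ i j else 0) :=
  sign_conj_eq_self_of_support ht htt fun i j h => hP i j (piece_ne_zero P Δ i j h)

/-- A piece whose index predicate has constant sign `εᵢεⱼ = −1` is NEGATED by the sign conjugation. [folklore] -/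
theorem piece_odd {t : SUN 3} {ε : Fin 3 → ℂ} (ht : (t : Matrix (Fin 3) (Fin 3) ℂ) = diagonal ε) (htt : t * t = 1)
    (P : Fin 3 → Fin 3 → Bool) (hP : ∀ i j, P i j = true → ε i * ε j = -1) (Δ : Matrix (Fin 3) (Fin 3) ℂ) :
    ((t⁻¹ : SUN 3) : Matrix (Fin 3) (Fin 3) ℂ) * (Matrix.of fun i j => if P i j then Δ i j else 0) * (t : Matrix (Fin 3) (Fin 3) ℂ) = -(Matrix.of fun i j => if P i j then Δ i j else 0) :=
  sign_conj_eq_neg_of_support ht htt fun i j h => hP i j (piece_ne_zero P Δ i j h)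

/-- Pieces on disjoint predicates have disjoint supports. [folklore] -/
theorem pieces_disjoint (P Q : Fin 3 → Fin 3 → Bool) (hPQ : ∀ i j, ¬(P i j = true ∧ Q i j = true)) (Δ : Matrix (Fin 3) (Fin 3) ℂ) (i j : Fin 3) :
    (Matrix.of fun i j => if P i j then Δ i j else 0) i j = 0 ∨ (Matrix.of fun i j => if Q i j then Δ i j else 0) i j = 0 := by
  by_cases hP : P i j = true
  · right
    have hQ : ¬(Q i j = true) := fun hQ => hPQ i j ⟨hP, hQ⟩
    simp only [Matrix.of_apply]
    rw [if_neg hQ]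
  · left
    simp only [Matrix.of_apply]
    rw [if_neg hP]

/-- The piece on `P || Q` is the sum of the pieces on `P` and on `Q` when `P`, `Q` are disjoint. [folklore] -/
theorem piece_or (P Q : Fin 3 → Fin 3 → Bool) (hPQ : ∀ i j, ¬(P i j = true ∧ Q i j = true)) (Δ : Matrix (Fin 3) (Fin 3) ℂ) :
    (Matrix.of fun i j => if (P i j || Q i j) then Δ i j else 0) = (Matrix.of fun i j => if P i j then Δ i j else 0) + (Matrix.of fun i j => if Q i j then Δ i j else 0) := by
  ext i j
  simp only [Matrix.add_apply, Matrix.of_apply]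
  by_cases hP : P i j = true
  · have hQ : ¬(Q i j = true) := fun hQ => hPQ i j ⟨hP, hQ⟩
    rw [if_pos hP, if_neg hQ, add_zero, if_pos (by rw [hP, Bool.true_or])]
  · by_cases hQ : Q i j = true
    · rw [if_neg hP, if_pos hQ, zero_add, if_pos (by rw [hQ, Bool.or_true])]
    · rw [if_neg hP, if_neg hQ, add_zero, if_neg (by rw [Bool.or_eq_true_iff]; exact fun h => h.elim hP hQ)]

/-- ★ **(L4) for `SU(3)`: block bounds imply the full bound at a diagonal tilt.**  Let `B = diagonal d` and suppose
`Var_{ν_B}(3 Re tr(gΔ)) ≤ v‖Δ‖_F²` holds for every `Δ` supported in the diagonal block `D = {(i,i)}` and for every `Δ` supported in one off-diagonal pair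
block `O_{ab} = {(a,b),(b,a)}`, `a ≠ b`.  Then it holds for every `Δ ∈ M₃(ℂ)` (the four blocks are separated by the sign matrices `diag(1,−1,−1)` and
`diag(−1,1,−1)` of `SU(3)`). [folklore] -/
theorem su3_varianceBoundAt_diagonal_of_blocks {d : Fin 3 → ℂ} {v : ℝ}
    (hD : ∀ Δ : Matrix (Fin 3) (Fin 3) ℂ, (∀ i j, i ≠ j → Δ i j = 0) →
      Var[fun g : SUN 3 => ((3 : ℕ) : ℝ) * ((g : Matrix (Fin 3) (Fin 3) ℂ) * Δ).trace.re ;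
        (haarSU 3).tilted fun g => ((3 : ℕ) : ℝ) * ((g : Matrix (Fin 3) (Fin 3) ℂ) * diagonal d).trace.re] ≤ v * frobNorm Δ ^ 2)
    (hO : ∀ a b : Fin 3, a ≠ b → ∀ Δ : Matrix (Fin 3) (Fin 3) ℂ, (∀ i j, Δ i j ≠ 0 → (i = a ∧ j = b) ∨ (i = b ∧ j = a)) →
      Var[fun g : SUN 3 => ((3 : ℕ) : ℝ) * ((g : Matrix (Fin 3) (Fin 3) ℂ) * Δ).trace.re ;
        (haarSU 3).tilted fun g => ((3 : ℕ) : ℝ) * ((g : Matrix (Fin 3) (Fin 3) ℂ) * diagonal d).trace.re] ≤ v * frobNorm Δ ^ 2)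
    (Δ : Matrix (Fin 3) (Fin 3) ℂ) :
    Var[fun g : SUN 3 => ((3 : ℕ) : ℝ) * ((g : Matrix (Fin 3) (Fin 3) ℂ) * Δ).trace.re ;
        (haarSU 3).tilted fun g => ((3 : ℕ) : ℝ) * ((g : Matrix (Fin 3) (Fin 3) ℂ) * diagonal d).trace.re] ≤ v * frobNorm Δ ^ 2 := by
  -- the four index predicates and the two unions
  let PD : Fin 3 → Fin 3 → Bool := fun i j => decide (i = j)
  let P12 : Fin 3 → Fin 3 → Bool := fun i j => decide ((i = 1 ∧ j = 2) ∨ (i = 2 ∧ j = 1))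
  let P01 : Fin 3 → Fin 3 → Bool := fun i j => decide ((i = 0 ∧ j = 1) ∨ (i = 1 ∧ j = 0))
  let P02 : Fin 3 → Fin 3 → Bool := fun i j => decide ((i = 0 ∧ j = 2) ∨ (i = 2 ∧ j = 0))
  -- the two sign elements of `SU(3)`
  let tA : SUN 3 := ⟨_, signA_mem⟩
  let tB : SUN 3 := ⟨_, signB_mem⟩
  have htAc : (tA : Matrix (Fin 3) (Fin 3) ℂ) = diagonal ![(1 : ℂ), -1, -1] := rfl
  have htBc : (tB : Matrix (Fin 3) (Fin 3) ℂ) = diagonal ![(-1 : ℂ), 1, -1] := rfl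
  have hεA : ∀ i : Fin 3, (![(1 : ℂ), -1, -1]) i * (![(1 : ℂ), -1, -1]) i = 1 := fun i => by fin_cases i <;> simp
  have hεB : ∀ i : Fin 3, (![(-1 : ℂ), 1, -1]) i * (![(-1 : ℂ), 1, -1]) i = 1 := fun i => by fin_cases i <;> simp
  have hAB : (tA : Matrix (Fin 3) (Fin 3) ℂ) * diagonal d * ((tA⁻¹ : SUN 3) : Matrix (Fin 3) (Fin 3) ℂ) = diagonal d := sign_conj_diagonal htAc signA_mul_self hεA d
  have hBB : (tB : Matrix (Fin 3) (Fin 3) ℂ) * diagonal d * ((tB⁻¹ : SUN 3) : Matrix (Fin 3) (Fin 3) ℂ) = diagonal d := sign_conj_diagonal htBc signB_mul_self hεB d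
  -- sign tables (9 entries each)
  have sD : ∀ i j, PD i j = true → (![(-1 : ℂ), 1, -1]) i * (![(-1 : ℂ), 1, -1]) j = 1 := fun i j h => by
    have hij : i = j := of_decide_eq_true h
    subst hij
    exact hεB i
  have s12 : ∀ i j, P12 i j = true → (![(-1 : ℂ), 1, -1]) i * (![(-1 : ℂ), 1, -1]) j = -1 := fun i j h => by
    rcases of_decide_eq_true h with ⟨rfl, rfl⟩ | ⟨rfl, rfl⟩ <;> simp
  have s02 : ∀ i j, P02 i j = true → (![(-1 : ℂ), 1, -1]) i * (![(-1 : ℂ), 1, -1]) j = 1 := fun i j h => by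
    rcases of_decide_eq_true h with ⟨rfl, rfl⟩ | ⟨rfl, rfl⟩ <;> simp
  have s01 : ∀ i j, P01 i j = true → (![(-1 : ℂ), 1, -1]) i * (![(-1 : ℂ), 1, -1]) j = -1 := fun i j h => by
    rcases of_decide_eq_true h with ⟨rfl, rfl⟩ | ⟨rfl, rfl⟩ <;> simp
  have sE : ∀ i j, (fun i j => PD i j || P12 i j) i j = true → (![(1 : ℂ), -1, -1]) i * (![(1 : ℂ), -1, -1]) j = 1 := fun i j h => by
    rcases (Bool.or_eq_true_iff.1 h) with h | h
    · have hij : i = j := of_decide_eq_true h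
      subst hij
      exact hεA i
    · rcases of_decide_eq_true h with ⟨rfl, rfl⟩ | ⟨rfl, rfl⟩ <;> simp
  have sO : ∀ i j, (fun i j => P02 i j || P01 i j) i j = true → (![(1 : ℂ), -1, -1]) i * (![(1 : ℂ), -1, -1]) j = -1 := fun i j h => by
    rcases (Bool.or_eq_true_iff.1 h) with h | h <;>
      rcases of_decide_eq_true h with ⟨rfl, rfl⟩ | ⟨rfl, rfl⟩ <;> simp
  -- disjointness of the predicates
  have dD12 : ∀ i j, ¬(PD i j = true ∧ P12 i j = true) := fun i j ⟨h1, h2⟩ => by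
    have hij : i = j := of_decide_eq_true h1
    rcases of_decide_eq_true h2 with ⟨rfl, rfl⟩ | ⟨rfl, rfl⟩ <;> exact absurd hij (by decide)
  have d0201 : ∀ i j, ¬(P02 i j = true ∧ P01 i j = true) := fun i j ⟨h1, h2⟩ => by
    rcases of_decide_eq_true h1 with ⟨rfl, rfl⟩ | ⟨rfl, rfl⟩ <;> exact absurd (of_decide_eq_true h2) (by decide)
  have dEO : ∀ i j, ¬((fun i j => PD i j || P12 i j) i j = true ∧ (fun i j => P02 i j || P01 i j) i j = true) := fun i j ⟨h1, h2⟩ => by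
    have e1 := sE i j h1
    have e2 := sO i j h2
    rw [e1] at e2
    norm_num at e2
  -- block bounds for the four pieces
  have bD := hD (Matrix.of fun i j => if PD i j then Δ i j else 0) fun i j hij => by
    simp only [Matrix.of_apply]
    rw [if_neg (by exact fun h => hij (of_decide_eq_true h))]
  have b12 := hO 1 2 (by decide) (Matrix.of fun i j => if P12 i j then Δ i j else 0) fun i j h => of_decide_eq_true (piece_ne_zero P12 Δ i j h)
  have b01 := hO 0 1 (by decide) (Matrix.of fun i j => if P01 i j then Δ i j else 0) fun i j h => of_decide_eq_true (piece_ne_zero P01 Δ i j h)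
  have b02 := hO 0 2 (by decide) (Matrix.of fun i j => if P02 i j then Δ i j else 0) fun i j h => of_decide_eq_true (piece_ne_zero P02 Δ i j h)
  -- step B (`diag(−1,1,−1)`): `D` even + `O₁₂` odd; `O₀₂` even + `O₀₁` odd
  have bE := varianceLinBound_add_of_sign_symmetry tB hBB (piece_even htBc signB_mul_self PD sD Δ) (piece_odd htBc signB_mul_self P12 s12 Δ)
    (pieces_disjoint PD P12 dD12 Δ) bD b12
  have bO := varianceLinBound_add_of_sign_symmetry tB hBB (piece_even htBc signB_mul_self P02 s02 Δ) (piece_odd htBc signB_mul_self P01 s01 Δ)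
    (pieces_disjoint P02 P01 d0201 Δ) b02 b01
  rw [← piece_or PD P12 dD12 Δ] at bE
  rw [← piece_or P02 P01 d0201 Δ] at bO
  -- step A (`diag(1,−1,−1)`): `D ⊕ O₁₂` even, `O₀₂ ⊕ O₀₁` odd
  have bAll := varianceLinBound_add_of_sign_symmetry tA hAB (piece_even htAc signA_mul_self _ sE Δ) (piece_odd htAc signA_mul_self _ sO Δ)
    (pieces_disjoint _ _ dEO Δ) bE bO
  -- the two unions exhaust `Δ`
  have hsplit : (Matrix.of fun i j => if (fun i j => PD i j || P12 i j) i j then Δ i j else 0) +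
      (Matrix.of fun i j => if (fun i j => P02 i j || P01 i j) i j then Δ i j else 0) = Δ := by
    ext i j
    fin_cases i <;> fin_cases j <;> simp [PD, P12, P01, P02, Matrix.add_apply]
  rw [hsplit] at bAll
  exact bAll

end SU3

end Summit.Ventures.YMGap.OneLinkTorusBlocks

end
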